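import Summits.BirchSwinnertonDyer.Rank1Residual.Additive.CensusX42ForallAnomalousWitness
import HarnessLib

/-!
# Rescaling the `p`-adic height datum, VI: on an ANOMALOUS row the `∀ Dh` packaging of the "up to a
# `p`-adic unit" inputs is INCOMPATIBLE WITH `BSD(E,p)` ITSELF — beyond the unit rows (cell `b2b-bsdres`,
# census cell `bsd-formula-census`, seat `b2b-bsdres-census-ctyper1` = conjecture-typer 1, gen 9;
# prequels `CensusX42ForallAnomalous.lean`, `CensusX42ForallAnomalousWitness.lean`)

HONEST FRAMING (cell `b2b-bsdres`, run/shared/lean/b2b/bsd-rank1-residual/, verbatim in every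
file): the goal of the cell is to DELETE the COMBINATION-SHAPED residual classes of the
Birch–Swinnerton-Dyer formula for ALL analytic-rank `≤ 1` elliptic curves over `ℚ` — "full BSD
formula for every rank `≤ 1` curve in class `C`" assembled STRICTLY from published theorems — so
that the rank-`≤ 1` remainder becomes exactly the CONSTRUCTION-SHAPED classes, which are TYPED
(missing-input `Prop`s), NOT attempted. This is not "finishing BSD". Census cell
(bsd-formula-census): research instrumentation; census output = EVIDENCE / conjecture items, never a
Literature fact; labels / RESIDUAL-MAP marks UNCHANGED (O7-ord OPEN; X3♯ / X4♯ CONSTRUCTION-SHAPED);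
nothing booked. Theorems only (no definition, no named fact); named facts enter as HYPOTHESES
(`hK` / `hWu`, `hGZ`, `hGZK`, `hmod`, `hmodD`); `BSDp W p` enters as a HYPOTHESIS (nothing asserted).

## What

The prequels refute the packaging `∀ Dh, LeadingTermClauses W p Dh → (norm-pinning X Dh)` on
anomalous UNIT rows (`ord_p #Ш_an = 0`). The unit literal was used only through Kato's inequality
`ord_p #Ш[p^∞] + ord_p ℓ ≤ ord_p #Ш_an` (p01's CORE, run on the GIVEN `ℓ`): what forces `ℓ = 1` at a
tuple is `ord_p #Ш_an ≤ ord_p #Ш[p^∞]`. That inequality is (the non-trivial half of) `BSD(E,p)` itself.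
* §8 `CensusX42.exists_identity_dvd_prime_of_iota_eq_of_pgz_of_padicValRat_le` — §2 of the first
  prequel with `ord_p s = 0` replaced by `ord_p s ≤ ord_p #Ш(E)[p^∞]` (`s = #Ш_an`); class forms
  `ClassX4Gord/ClassX3Gord.leadingTermClauses_inv_prime_of_{katoHalf,wuthrichHalf}_of_branchPAdicGrossZagier_of_padicValRat_le_of_anomalous`
  (`p⁻¹ · Dh` is again a (B)-datum).
* §9 WITNESSES with `BSDp W p` as the hypothesis in place of the unit literal:
  `ClassX4Gord.not_forall_leadingTermClauses_imp_branchPAdicGrossZagierOdd_of_bsdp_of_anomalous`,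
  `ClassX3Gord.not_forall_leadingTermClauses_imp_branchPAdicGrossZagierOdd_of_bsdp_of_anomalous`,
  `ClassX4Gord.not_forall_leadingTermClauses_imp_censusX42Val_of_bsdp_of_anomalous` (both parities): on
  an ANOMALOUS (G-ord, `e = 2`) row of analytic rank `1` with Kato's (resp. Wuthrich's) half, GZK,
  modularity and ONE (B)-datum, **`BSD(E,p)` REFUTES `∀ Dh, LeadingTermClauses → Schneider ∧
  BranchPAdicGrossZagierOddAt` (and `→ ValRelationAt`)**; the even-branch form is verbatim analogous
  (`hE` in the §8 class form; unit-row version in the prequel).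
CONSEQUENCE (the vacuity is total on anomalous rows, unit literal or not): a theorem
`H, (∀ Dh, LeadingTermClauses W p Dh → X Dh) ⊢ BSDp W p` whose remaining binders `H` contain (or yield)
the half-Euler-system fact, GZK, modularity, `hmodD`, the class with `e = 2`, `r_an = 1` and a
(B)-datum is, restricted to `¬ ReductionNonAnomalous W p`, a theorem with UNSATISFIABLE hypotheses:
`H ∧ packaging ⊢ BSDp` and (§9) `H ∧ BSDp ⊢ ¬ packaging`. So on anomalous rows the `hGZ` / `hrel`
`∀ Dh` packaging can hold ONLY where `BSD(E,p)` FAILS — it is not a usable hypothesis shape there;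
consumers take the pointwise binders (one `Dh` with `hB`, `hS`, `hGZ` / `hrel`) or carry
`ReductionNonAnomalous W p` (under which the (B)-data are one unit class in norm and the packaging is
the pointwise input up to a unit). This closes the question left open in the prequel's INBOX note
(non-unit anomalous rows). Nothing about any curve is asserted; nothing booked; no mark / label moved.

References: [Delbourgo2002] J. Number Theory 95 (2002) p. 39 (`ℓ_p(E)`), Thm. (B) (p. 40);
[Kato2004Asterisque] Thm. 17.4 (3); [Wuthrich2014] Thm. 16, Lemma 20; [MazurTateTeitelbaum1986Invent]
§I.13–I.14, §II.4; [GrossZagier1986] Thm. I.(7.3); [Miller2011LMS] Def. 1.1 (`BSD(E,p)`).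
-/

set_option autoImplicit false

noncomputable section

open scoped Classical MatrixGroups ModularForm NumberField

open CongruenceSubgroup WeierstrassCurve NumberField Literature.NumberTheory.EllipticCurves
  Literature.NumberTheory.EllipticCurves.ModularForms
  Literature.NumberTheory.EllipticCurves.Rank1Residual
  Literature.NumberTheory.EllipticCurves.Rank1Residual.Typed
  Literature.NumberTheory.EllipticCurves.Delbourgo2002
  Literature.NumberTheory.GaloisRepresentations
  Literature.Barriers.BirchSwinnertonDyer
  IsDedekindDomain

namespace Summit.BirchSwinnertonDyer.Rank1Residual.Additive

namespace CensusX42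

variable {W : WeierstrassCurve ℚ} {p : ℕ} [hp : Fact p.Prime]

/-! ### §8 `ℓ = 1` at every Kato tuple as soon as `ord_p #Ш_an ≤ ord_p #Ш[p^∞]`; `p⁻¹ · Dh` is a (B)-datum -/

/-- **`ord_p #Ш_an ≤ ord_p #Ш(E)[p^∞]` ⟹ `ℓ = 1 ∣ p` at the tuple** (rank one, cell-agnostic; the
first prequel's §2 with the unit literal replaced by the BSD-half inequality): at a cyclotomic tuple
carrying Kato's `ι g = C(u·ϖ)·B`, a (B)-datum `Dh` with the rider and the `p`-adic Gross–Zagier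
identity for the same `(ϖ, B)` has its clause-3 factor dividing `p` (Kato: `ord #Ш + ord ℓ ≤ ord #Ш_an`).
[cite: Delbourgo2002, Theorem (B) (p. 40) and p. 39 (ℓ_p(E))] [cite: Kato2004Asterisque, Thm. 17.4 (3) (p. 273)]
[cite: Miller2011LMS, Def. 1.1] -/
theorem exists_identity_dvd_prime_of_iota_eq_of_pgz_of_padicValRat_le [W.IsElliptic] [W.IsGloballyMinimal]
    (hp2 : p ≠ 2) (hGZK : rank_eq_analyticRank_of_analyticRank_le_one) (hmod : hasEntireLFunction_rat)
    (hr : W.analyticRank = 1) {Dh : PAdicHeightData W p} (hB : LeadingTermClauses W p Dh)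
    (hS : SchneiderConjecture Dh)
    {κ : ZpExtension ℚ p} {γ : Field.absoluteGaloisGroup ℚ}
    (hκ : κ.IsCyclotomic) (hγ : κ.IsTopGenerator γ) (hγ' : IsCyclotomicVariable p γ)
    (D : W.SelmerDualData κ γ) [Module.Finite (IwasawaAlgebra p) D.X] (hX : D.IsTorsion)
    {fE g : IwasawaAlgebra p} (hchar : D.charIdeal = Ideal.span {fE}) (hg : g ∈ D.charIdeal)
    {u : ℤ_[p]ˣ} {ϖ : ℚ} {B : PowerSeries ℚ_[p]}
    (hι : iwasawaToPowerSeries p g =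
      PowerSeries.C (((u : ℤ_[p]) : ℚ_[p]) * (ϖ : ℚ_[p])) * B)
    {u' : ℤ_[p]ˣ} {q : ℚ}
    (hlead : W.leadingLCoeff = (q : ℂ) * (W.realPeriodRat : ℂ) * (W.regulator : ℂ))
    (hpgz : ((ϖ : ℚ) : ℚ_[p]) * PowerSeries.coeff W.mordellWeilRank B *
        padicLog p (cyclotomicGenerator p) ^ W.mordellWeilRank =
      ((u' : ℤ_[p]) : ℚ_[p]) * (q : ℚ_[p]) * padicRegulator Dh)
    {s : ℚ} (hs : shaAn W = (s : ℂ))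
    (hv : padicValRat p s ≤ padicValNat p (Nat.card (AddCommGroup.primaryComponent W.sha p))) :
    Finite (AddCommGroup.primaryComponent W.sha p) ∧
    ∃ (u₀ : ℤ_[p]ˣ) (ℓ : ℕ), ℓ ∣ p ∧
      ((PowerSeries.coeff W.mordellWeilRank fE : ℤ_[p]) : ℚ_[p]) *
          padicLog p (cyclotomicGenerator p) ^ W.mordellWeilRank * (W.torsionOrder : ℚ_[p]) ^ 2 =
        ((u₀ : ℤ_[p]) : ℚ_[p]) * (ℓ : ℚ_[p]) *
          ((Nat.card (AddCommGroup.primaryComponent W.sha p) : ℚ_[p]) * padicRegulator Dh *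
            W.tamagawaProduct) := by
  have hpP : p.Prime := hp.out
  obtain ⟨hmw, hfinSha⟩ := hGZK W (by rw [hr])
  have hr1 : W.mordellWeilRank = 1 := by rw [hmw, hr]
  haveI : Finite W.sha := hfinSha
  have hfin : Finite (AddCommGroup.primaryComponent W.sha p) := inferInstance
  obtain ⟨u₀, ℓ, hℓp, -, heq⟩ := (hB κ γ hκ hγ hγ' D hX fE hchar).2.2 hS hfin
  refine ⟨hfin, u₀, ℓ, ?_, heq⟩
  -- the identity in rank-one form
  have heq1 := heq
  rw [hr1, pow_one] at heq1 hpgz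
  -- `q ≠ 0` (modularity), hence `[T¹](ϖ·B) ≠ 0` from the typed identity and the rider
  have hL0 : W.leadingLCoeff ≠ 0 := W.leadingLCoeff_ne_zero_holds (hmod W)
  have hq0 : q ≠ 0 := by
    rintro rfl
    apply hL0
    rw [hlead]
    simp
  have hqQ : ((q : ℚ) : ℚ_[p]) ≠ 0 := by exact_mod_cast hq0
  have hu'0 : ((u' : ℤ_[p]) : ℚ_[p]) ≠ 0 := coe_units_ne_zero p u'
  have hRg0 : padicRegulator Dh ≠ 0 := hS
  obtain ⟨w, hw⟩ := exists_unit_padicLog_cyclotomicGenerator (p := p) hp2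
  have hpQ : (p : ℚ_[p]) ≠ 0 := by exact_mod_cast hpP.ne_zero
  have hlog0 : padicLog p (cyclotomicGenerator p : ℚ_[p]) ≠ 0 := by
    rw [hw]; exact mul_ne_zero hpQ (coe_units_ne_zero p w)
  have hlogv : (padicLog p (cyclotomicGenerator p : ℚ_[p])).valuation = 1 := by
    rw [hw, Padic.valuation_mul hpQ (coe_units_ne_zero p w), Padic.valuation_p,
      valuation_coe_units_eq_zero, add_zero]
  have hc1 : PowerSeries.coeff 1 (PowerSeries.C (ϖ : ℚ_[p]) * B) =
      ((ϖ : ℚ) : ℚ_[p]) * PowerSeries.coeff 1 B := by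
    rw [PowerSeries.coeff_C_mul]
  have hprod0 : ((ϖ : ℚ) : ℚ_[p]) * PowerSeries.coeff 1 B ≠ 0 := by
    intro hz
    rw [hz, zero_mul] at hpgz
    exact mul_ne_zero (mul_ne_zero hu'0 hqQ) hRg0 hpgz.symm
  have hne : PowerSeries.coeff 1 (PowerSeries.C (ϖ : ℚ_[p]) * B) ≠ 0 := by rw [hc1]; exact hprod0
  have hℓ0 : ℓ ≠ 0 := by
    rintro rfl
    exact hpP.ne_zero (pow_eq_zero_iff (n := 2) (by norm_num) |>.mp (zero_dvd_iff.mp hℓp))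
  -- §1 on the identity in hand
  have hle := valuation_le_of_identity_of_iota_eq hp2 hr1 hB hκ hγ hγ' D hX hchar hg hι hne hS
    hℓ0 heq1
  rw [hc1] at hle
  -- the valuation of `[T¹](ϖB)` from the typed identity
  have hval := congrArg Padic.valuation hpgz
  rw [Padic.valuation_mul hprod0 hlog0, hlogv, Padic.valuation_mul (mul_ne_zero hu'0 hqQ) hRg0,
    Padic.valuation_mul hu'0 hqQ, valuation_coe_units_eq_zero, zero_add, Padic.valuation_ratCast] at hval
  -- `ord_p (q·#T²/∏c) ≤ ord_p #Ш[p^∞]`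
  have hT0 : W.torsionOrder ≠ 0 := (W.torsionOrder_pos_holds).ne'
  have hTq : (W.torsionOrder : ℚ) ≠ 0 := by exact_mod_cast hT0
  have hPq : (W.tamagawaProduct : ℚ) ≠ 0 := by
    exact_mod_cast (W.tamagawaProduct_pos_holds : 0 < W.tamagawaProduct).ne'
  have hs' : s = q * (W.torsionOrder : ℚ) ^ 2 / (W.tamagawaProduct : ℚ) := by
    have h := hs.symm.trans (shaAn_eq_of_leadingLCoeff_eq W hlead)
    exact_mod_cast h
  rw [hs', padicValRat.div (mul_ne_zero hq0 (pow_ne_zero 2 hTq)) hPq,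
    padicValRat.mul hq0 (pow_ne_zero 2 hTq), padicValRat.pow, padicValRat.of_nat,
    padicValRat.of_nat] at hv
  -- so `ord_p ℓ + ord_p #Ш[p^∞] ≤ ord_p s ≤ ord_p #Ш[p^∞]`, i.e. `ord_p ℓ = 0`, i.e. `ℓ = 1`
  have hℓv : padicValNat p ℓ = 0 := by
    have h2 : (0 : ℤ) ≤ padicValNat p ℓ := by exact_mod_cast Nat.zero_le _
    have h1 : (padicValNat p ℓ : ℤ) ≤ 0 := by
      push_cast at hle hval hv ⊢
      linarith
    exact_mod_cast le_antisymm h1 h2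
  obtain ⟨k, -, rfl⟩ := (Nat.dvd_prime_pow hpP).mp hℓp
  rw [padicValNat.prime_pow] at hℓv
  rw [hℓv, pow_zero]
  exact one_dvd p

end CensusX42

open CensusX42

variable {W : WeierstrassCurve ℚ} [W.IsElliptic] [W.IsGloballyMinimal] {p : ℕ} [hp : Fact p.Prime]

/-- **X4♯(G-ord) ∩ `I₀*` ∩ {`ρ̄_{E,p}` onto}, EVERY odd `p`, `r_an = 1`, ANOMALOUS,
`ord_p #Ш_an ≤ ord_p #Ш[p^∞]`:** a (B)-datum `Dh` with the rider and the typed branch `p`-adic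
Gross–Zagier of the parity of `(p−1)/2` has `p⁻¹ · Dh` AGAIN a (B)-datum (Kato's brick at every tuple,
§8, first prequel §3). [cite: Kato2004Asterisque, Thm. 17.4 (3) (p. 273)] [cite: Wuthrich2014, Lemma 20 (p. 399)]
[cite: Delbourgo2002, Theorem (B) (p. 40) and p. 39 (ℓ_p(E))] -/
theorem ClassX4Gord.leadingTermClauses_inv_prime_of_katoHalf_of_branchPAdicGrossZagier_of_padicValRat_le_of_anomalous
    (hK : Wuthrich2014.kato_halfEigenCharIdeal_dvd_cyclotomicPrime_of_surjective)
    (hGZK : rank_eq_analyticRank_of_analyticRank_le_one) (hmod : hasEntireLFunction_rat)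
    (hmodD : nonempty_modularParametrizationData) (hX : ClassX4Gord W p)
    (he : semistabilityIndex W p = 2) (hsurj : Surj W p) (hr : W.analyticRank = 1)
    (hanom : ¬ ReductionNonAnomalous W p)
    {Dh Dh' : PAdicHeightData W p} (hB : LeadingTermClauses W p Dh) (hS : SchneiderConjecture Dh)
    (hE : p % 4 = 1 → BranchPAdicGrossZagierAt W p Dh)
    (hO : p % 4 = 3 → BranchPAdicGrossZagierOddAt W p Dh)
    (hc : ∀ P Q, Dh'.pairing P Q = (p : ℚ_[p])⁻¹ * Dh.pairing P Q)
    {s : ℚ} (hs : shaAn W = (s : ℂ))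
    (hv : padicValRat p s ≤ padicValNat p (Nat.card (AddCommGroup.primaryComponent W.sha p))) :
    LeadingTermClauses W p Dh' := by
  have hp2 : p ≠ 2 := hX.addv.1
  have hr1 : W.mordellWeilRank = 1 := by rw [(hGZK W hr.le).1, hr]
  obtain ⟨V, iV, iVm, C, hV, hC⟩ := hX.exists_goodOrd_pStar_twist_model W p he
  haveI : NeZero (V.conductorNorm ℤ) := ⟨(V.conductorNorm_pos_holds).ne'⟩
  obtain ⟨Dm⟩ := hmodD V
  obtain ⟨ϖ, hϖ⟩ := exists_periodRatio_parity (p := p) V Dm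
  have hj := padicValRat_j_nonneg_of_typeGOrd W p hX.typeGOrd
  have hsV : Surj V p := (surj_iff_of_model_twist V p (pStar_ne_zero p) ⟨C, hC⟩).mp hsurj
  have hsurjV : ∀ n : ℕ, V.HasSurjectiveModNGaloisRep (p ^ n : ℕ) :=
    V.forall_hasSurjectiveModNGaloisRep_pow_of_goodOrdinary_of_surj p hp2 hV.1 hV.2 hsV
  have hodd4 : p % 4 = 1 ∨ p % 4 = 3 := by obtain ⟨k, hk⟩ := hp.out.odd_of_ne_two hp2; omega
  refine leadingTermClauses_of_pairing_eq_inv_prime_mul_of_anomalous hanom hr1 hB hc ?_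
  intro κ γ hκ hγ hγ' D _ hXt fE hchar _ _
  obtain ⟨-, g, hg, u, hι⟩ := isTorsion_and_exists_iota_eq_branch_of_katoComponent W p
    (Kato2004.charIdeal_dvd_padicLFunctionBranch_component_of_surjective_of_half hK) hj hp2 V
    ⟨C, hC⟩ (Or.inl hV) hsurjV hκ hγ hγ' Dm.isNewformOf D ϖ hϖ
  rcases hodd4 with h1 | h3
  · have hev : Even (p / 2) := ⟨p / 4, by omega⟩
    have hC' : C • V.quadraticTwist (p : ℚ) = W := by
      rw [pStar_eq_of_mod_four p (Or.inl h1), if_pos h1] at hC; exact hC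
    rw [if_pos hev] at hϖ hι
    obtain ⟨u', q, hlead, hpgz⟩ := hE h1 V h1 ⟨C, hC'⟩ hV Dm.isNewformOf ϖ hϖ
    exact (exists_identity_dvd_prime_of_iota_eq_of_pgz_of_padicValRat_le hp2 hGZK hmod hr hB hS hκ hγ
      hγ' D hXt hchar hg hι hlead hpgz hs hv).2
  · have hnev : ¬ Even (p / 2) := by rw [Nat.not_even_iff_odd]; exact ⟨p / 4, by omega⟩
    have hC' : C • V.quadraticTwist (-(p : ℚ)) = W := by
      rw [pStar_eq_of_mod_four p (Or.inr h3), if_neg (by omega)] at hC; exact hC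
    rw [if_neg hnev] at hϖ hι
    obtain ⟨u', q, hlead, hpgz⟩ := hO h3 V h3 ⟨C, hC'⟩ hV Dm.isNewformOf ϖ hϖ
    exact (exists_identity_dvd_prime_of_iota_eq_of_pgz_of_padicValRat_le hp2 hGZK hmod hr hB hS hκ hγ
      hγ' D hXt hchar hg hι hlead hpgz hs hv).2

/-- **X3♯(G-ord) ∩ `I₀*` (reducible `E[p]`), EVERY odd `p`, `r_an = 1`, ANOMALOUS,
`ord_p #Ш_an ≤ ord_p #Ш[p^∞]`:** the same from Wuthrich's Thm. 16 half. [cite: Wuthrich2014, Thm. 16 (p. 397)]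
[cite: Delbourgo2002, Theorem (B) (p. 40) and p. 39 (ℓ_p(E))] -/
theorem ClassX3Gord.leadingTermClauses_inv_prime_of_wuthrichHalf_of_branchPAdicGrossZagier_of_padicValRat_le_of_anomalous
    (hWu : Wuthrich2014.thm16_halfEigenCharIdeal_dvd_cyclotomicPrime)
    (hGZK : rank_eq_analyticRank_of_analyticRank_le_one) (hmod : hasEntireLFunction_rat)
    (hmodD : nonempty_modularParametrizationData) (hX : ClassX3Gord W p) (hp2 : p ≠ 2)
    (he : semistabilityIndex W p = 2) (hr : W.analyticRank = 1)
    (hanom : ¬ ReductionNonAnomalous W p)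
    {Dh Dh' : PAdicHeightData W p} (hB : LeadingTermClauses W p Dh) (hS : SchneiderConjecture Dh)
    (hE : p % 4 = 1 → BranchPAdicGrossZagierAt W p Dh)
    (hO : p % 4 = 3 → BranchPAdicGrossZagierOddAt W p Dh)
    (hc : ∀ P Q, Dh'.pairing P Q = (p : ℚ_[p])⁻¹ * Dh.pairing P Q)
    {s : ℚ} (hs : shaAn W = (s : ℂ))
    (hv : padicValRat p s ≤ padicValNat p (Nat.card (AddCommGroup.primaryComponent W.sha p))) :
    LeadingTermClauses W p Dh' := by
  have hr1 : W.mordellWeilRank = 1 := by rw [(hGZK W hr.le).1, hr]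
  obtain ⟨V, iV, iVm, C, hV, hC⟩ := hX.exists_goodOrd_pStar_twist_model W p hp2 he
  haveI : NeZero (V.conductorNorm ℤ) := ⟨(V.conductorNorm_pos_holds).ne'⟩
  obtain ⟨Dm⟩ := hmodD V
  obtain ⟨ϖ, hϖ⟩ := exists_periodRatio_parity (p := p) V Dm
  have hj := padicValRat_j_nonneg_of_typeGOrd W p hX.typeGOrd
  have hodd4 : p % 4 = 1 ∨ p % 4 = 3 := by obtain ⟨k, hk⟩ := hp.out.odd_of_ne_two hp2; omega
  refine leadingTermClauses_of_pairing_eq_inv_prime_mul_of_anomalous hanom hr1 hB hc ?_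
  intro κ γ hκ hγ hγ' D _ hXt fE hchar _ _
  obtain ⟨-, g, hg, u, hι⟩ := isTorsion_and_exists_iota_eq_branch_of_wuthrichComponent W p
    (Wuthrich2014.charIdeal_dvd_padicLFunctionBranch_component_of_half hWu) hj hp2 V
    ⟨C, hC⟩ (Or.inl hV) hX.classX3.1 hκ hγ hγ' Dm.isNewformOf D ϖ hϖ
  rcases hodd4 with h1 | h3
  · have hev : Even (p / 2) := ⟨p / 4, by omega⟩
    have hC' : C • V.quadraticTwist (p : ℚ) = W := by
      rw [pStar_eq_of_mod_four p (Or.inl h1), if_pos h1] at hC; exact hC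
    rw [if_pos hev] at hϖ hι
    obtain ⟨u', q, hlead, hpgz⟩ := hE h1 V h1 ⟨C, hC'⟩ hV Dm.isNewformOf ϖ hϖ
    exact (exists_identity_dvd_prime_of_iota_eq_of_pgz_of_padicValRat_le hp2 hGZK hmod hr hB hS hκ hγ
      hγ' D hXt hchar hg hι hlead hpgz hs hv).2
  · have hnev : ¬ Even (p / 2) := by rw [Nat.not_even_iff_odd]; exact ⟨p / 4, by omega⟩
    have hC' : C • V.quadraticTwist (-(p : ℚ)) = W := by
      rw [pStar_eq_of_mod_four p (Or.inr h3), if_neg (by omega)] at hC; exact hC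
    rw [if_neg hnev] at hϖ hι
    obtain ⟨u', q, hlead, hpgz⟩ := hO h3 V h3 ⟨C, hC'⟩ hV Dm.isNewformOf ϖ hϖ
    exact (exists_identity_dvd_prime_of_iota_eq_of_pgz_of_padicValRat_le hp2 hGZK hmod hr hB hS hκ hγ
      hγ' D hXt hchar hg hι hlead hpgz hs hv).2

/-! ### §9 WITNESSES: on an anomalous row `BSD(E,p)` refutes the `∀ Dh` packaging -/

/-- **X4♯(G-ord) ∩ `I₀*` ∩ {`ρ̄` onto}, ODD branch (`p ≡ 3 (mod 4)`, `p = 3` included), `r_an = 1`,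
ANOMALOUS, one (B)-datum: `BSD(E,p)` REFUTES n1011's packaging
`∀ Dh, LeadingTermClauses → Schneider ∧ BranchPAdicGrossZagierOddAt`.** Hence every theorem deriving
`BSDp W p` from that packaging (+ these published inputs) is vacuous on the anomalous rows.
[cite: Delbourgo2002, Theorem (B) (p. 40) and p. 39 (ℓ_p(E))] [cite: Kato2004Asterisque, Thm. 17.4 (3) (p. 273)]
[cite: Miller2011LMS, Def. 1.1] -/
theorem ClassX4Gord.not_forall_leadingTermClauses_imp_branchPAdicGrossZagierOdd_of_bsdp_of_anomalous
    (hK : Wuthrich2014.kato_halfEigenCharIdeal_dvd_cyclotomicPrime_of_surjective)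
    (hGZK : rank_eq_analyticRank_of_analyticRank_le_one) (hmod : hasEntireLFunction_rat)
    (hmodD : nonempty_modularParametrizationData) (hX : ClassX4Gord W p)
    (he : semistabilityIndex W p = 2) (hp4 : p % 4 = 3) (hsurj : Surj W p) (hr : W.analyticRank = 1)
    (hanom : ¬ ReductionNonAnomalous W p) (hDh : ∃ Dh : PAdicHeightData W p, LeadingTermClauses W p Dh)
    (hbsd : BSDp W p) :
    ¬ ∀ Dh : PAdicHeightData W p, LeadingTermClauses W p Dh →
        SchneiderConjecture Dh ∧ BranchPAdicGrossZagierOddAt W p Dh := by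
  intro hall
  have hr1 : W.mordellWeilRank = 1 := by rw [(hGZK W hr.le).1, hr]
  obtain ⟨-, -, s, hs, hvs⟩ := hbsd
  obtain ⟨Dh, hB⟩ := hDh
  obtain ⟨hS, hGZ⟩ := hall Dh hB
  obtain ⟨Dh', hc⟩ := CensusX42.exists_pairing_eq_mul ((p : ℚ_[p])⁻¹) Dh
  have hB' := hX.leadingTermClauses_inv_prime_of_katoHalf_of_branchPAdicGrossZagier_of_padicValRat_le_of_anomalous
    hK hGZK hmod hmodD he hsurj hr hanom hB hS (fun h1 ↦ absurd h1 (by omega)) (fun _ ↦ hGZ) hc hs hvs.le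
  obtain ⟨-, hGZ'⟩ := hall Dh' hB'
  obtain ⟨V, iV, iVm, C, hV, hC⟩ := hX.exists_goodOrd_pStar_twist_model W p he
  haveI : NeZero (V.conductorNorm ℤ) := ⟨(V.conductorNorm_pos_holds).ne'⟩
  obtain ⟨Dm⟩ := hmodD V
  obtain ⟨ϖ, -, hϖ⟩ := exists_rat_mul_imaginaryPeriodRat_eq_minusPeriod Dm
  have hC' : C • V.quadraticTwist (-(p : ℚ)) = W := by
    rw [pStar_eq_of_mod_four p (Or.inr hp4), if_neg (by omega)] at hC; exact hC
  obtain ⟨u, q, hlead, hpgz⟩ := hGZ V hp4 ⟨C, hC'⟩ hV Dm.isNewformOf ϖ hϖ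
  obtain ⟨u', q', hlead', hpgz'⟩ := hGZ' V hp4 ⟨C, hC'⟩ hV Dm.isNewformOf ϖ hϖ
  exact CensusX42.false_of_unit_identity_of_unit_identity_inv_prime hmod hr1 hS hc hlead hlead'
    hpgz hpgz'

/-- **X3♯(G-ord) ∩ `I₀*` (reducible `E[p]`), ODD branch, EVERY `p ≡ 3 (mod 4)` (`p = 3` included),
`r_an = 1`, ANOMALOUS, one (B)-datum: `BSD(E,p)` REFUTES
`∀ Dh, LeadingTermClauses → Schneider ∧ BranchPAdicGrossZagierOddAt`** (Wuthrich's Thm. 16 half).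
[cite: Wuthrich2014, Thm. 16 (p. 397)] [cite: Delbourgo2002, Theorem (B) (p. 40) and p. 39 (ℓ_p(E))]
[cite: Miller2011LMS, Def. 1.1] -/
theorem ClassX3Gord.not_forall_leadingTermClauses_imp_branchPAdicGrossZagierOdd_of_bsdp_of_anomalous
    (hWu : Wuthrich2014.thm16_halfEigenCharIdeal_dvd_cyclotomicPrime)
    (hGZK : rank_eq_analyticRank_of_analyticRank_le_one) (hmod : hasEntireLFunction_rat)
    (hmodD : nonempty_modularParametrizationData) (hX : ClassX3Gord W p)
    (he : semistabilityIndex W p = 2) (hp4 : p % 4 = 3) (hr : W.analyticRank = 1)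
    (hanom : ¬ ReductionNonAnomalous W p) (hDh : ∃ Dh : PAdicHeightData W p, LeadingTermClauses W p Dh)
    (hbsd : BSDp W p) :
    ¬ ∀ Dh : PAdicHeightData W p, LeadingTermClauses W p Dh →
        SchneiderConjecture Dh ∧ BranchPAdicGrossZagierOddAt W p Dh := by
  intro hall
  have hp2 : p ≠ 2 := by omega
  have hr1 : W.mordellWeilRank = 1 := by rw [(hGZK W hr.le).1, hr]
  obtain ⟨-, -, s, hs, hvs⟩ := hbsd
  obtain ⟨Dh, hB⟩ := hDh
  obtain ⟨hS, hGZ⟩ := hall Dh hB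
  obtain ⟨Dh', hc⟩ := CensusX42.exists_pairing_eq_mul ((p : ℚ_[p])⁻¹) Dh
  have hB' := hX.leadingTermClauses_inv_prime_of_wuthrichHalf_of_branchPAdicGrossZagier_of_padicValRat_le_of_anomalous
    hWu hGZK hmod hmodD hp2 he hr hanom hB hS (fun h1 ↦ absurd h1 (by omega)) (fun _ ↦ hGZ) hc hs hvs.le
  obtain ⟨-, hGZ'⟩ := hall Dh' hB'
  obtain ⟨V, iV, iVm, C, hV, hC⟩ := hX.exists_goodOrd_pStar_twist_model W p hp2 he
  haveI : NeZero (V.conductorNorm ℤ) := ⟨(V.conductorNorm_pos_holds).ne'⟩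
  obtain ⟨Dm⟩ := hmodD V
  obtain ⟨ϖ, -, hϖ⟩ := exists_rat_mul_imaginaryPeriodRat_eq_minusPeriod Dm
  have hC' : C • V.quadraticTwist (-(p : ℚ)) = W := by
    rw [pStar_eq_of_mod_four p (Or.inr hp4), if_neg (by omega)] at hC; exact hC
  obtain ⟨u, q, hlead, hpgz⟩ := hGZ V hp4 ⟨C, hC'⟩ hV Dm.isNewformOf ϖ hϖ
  obtain ⟨u', q', hlead', hpgz'⟩ := hGZ' V hp4 ⟨C, hC'⟩ hV Dm.isNewformOf ϖ hϖ
  exact CensusX42.false_of_unit_identity_of_unit_identity_inv_prime hmod hr1 hS hc hlead hlead'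
    hpgz hpgz'

/-- **(G-ord, `e = 2`) ∩ {`ρ̄` onto}, EVERY odd `p`, `r_an = 1`, ANOMALOUS, one (B)-datum: `BSD(E,p)`
REFUTES this seat's window-grade packaging `∀ Dh, LeadingTermClauses → CensusX42.ValRelationAt W p Dh`.**
[cite: Delbourgo1998, §2.5 BS-D(p) (ii) (pp. 151–152) (shape only)] [cite: Delbourgo2002, Theorem (B) (p. 40)]
[cite: GrossZagier1986, Thm. I.(7.3)] [cite: Miller2011LMS, Def. 1.1] -/
theorem ClassX4Gord.not_forall_leadingTermClauses_imp_censusX42Val_of_bsdp_of_anomalous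
    (hK : Wuthrich2014.kato_halfEigenCharIdeal_dvd_cyclotomicPrime_of_surjective)
    (hGZ : GrossZagier1986_thm_I_7_3) (hGZK : rank_eq_analyticRank_of_analyticRank_le_one)
    (hmod : hasEntireLFunction_rat) (hmodD : nonempty_modularParametrizationData) (hX : ClassX4Gord W p)
    (he : semistabilityIndex W p = 2) (hsurj : Surj W p) (hr : W.analyticRank = 1)
    (hanom : ¬ ReductionNonAnomalous W p) (hDh : ∃ Dh : PAdicHeightData W p, LeadingTermClauses W p Dh)
    (hbsd : BSDp W p) :
    ¬ ∀ Dh : PAdicHeightData W p, LeadingTermClauses W p Dh → CensusX42.ValRelationAt W p Dh := by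
  intro hall
  have hp2 : p ≠ 2 := hX.addv.1
  have hr1 : W.mordellWeilRank = 1 := by rw [(hGZK W hr.le).1, hr]
  obtain ⟨-, -, s, hs, hvs⟩ := hbsd
  obtain ⟨Dh, hB⟩ := hDh
  have hV := hall Dh hB
  have hS : SchneiderConjecture Dh :=
    CensusX42.schneider_of_valRelationAt hGZ hGZK hmodD hp2 hX.typeGOrd hX.addv.2 he hr hV
  obtain ⟨Dh', hc⟩ := CensusX42.exists_pairing_eq_mul ((p : ℚ_[p])⁻¹) Dh
  have hB' := hX.leadingTermClauses_inv_prime_of_katoHalf_of_branchPAdicGrossZagier_of_padicValRat_le_of_anomalous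
    hK hGZK hmod hmodD he hsurj hr hanom hB hS
    (fun _ ↦ CensusX42.branchPAdicGrossZagierAt_of_valRelationAt hGZ hGZK W hX.addv.2 hr Dh hV)
    (fun _ ↦ CensusX42.branchPAdicGrossZagierOddAt_of_valRelationAt hGZ hGZK W hX.addv.2 hr Dh hV) hc hs
    hvs.le
  have hV' := hall Dh' hB'
  have hn := CensusX42.norm_padicRegulator_eq_of_valRelationAt_of_valRelationAt hGZ hGZK hmodD hp2
    hX.typeGOrd hX.addv.2 he hr hV' hV
  rw [CensusX42.padicRegulator_eq_of_pairing_eq_mul hc, hr1, pow_one, norm_mul, norm_inv,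
    Padic.norm_p, inv_inv] at hn
  have hR : ‖padicRegulator Dh‖ ≠ 0 := norm_ne_zero_iff.mpr hS
  have hp1 : (1 : ℝ) < p := by exact_mod_cast hp.out.one_lt
  have h1 : (p : ℝ) = 1 := mul_right_cancel₀ hR (hn.trans (one_mul _).symm)
  linarith

end Summit.BirchSwinnertonDyer.Rank1Residual.Additive

end
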